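import Summits.BirchSwinnertonDyer.BirchSwinnertonDyer.Theorems.ManinLocalTwoThreePinningThreeTwentyStagesB
import HarnessLib

/-!
# Level 320 by the PINNING KERNEL IN `S₂` — staged sieve certificates (part 6 of 7)

Cell `bsd-f2-manin`, route `ManinLocalTwoThree`, crux C2 `ManinOddAtFour` (stmt-BirchSwinnertonDyer-22967), an g57 (pipeline of an g56);
`--supports stmt-BirchSwinnertonDyer-22967` (helper).  The kernel certificates `hst4c11` … `hst5` (stages 4–5) of the staged box sieve
of level 320 (stage `k` maps the live list `L_k` of `…PinningThreeTwentyTables` into `L_{k+1}`; large stages in chunks of at most `EXTCAP = 160` extensions (`3·EXTCAP/(4·r)` at a stage with `r ≥ 2` relations),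
glued by part D's `sieveStep_subset_of_chunks`), split off the main file so that every file stays inside the farm's per-file
budget (depth `K = 176`: at `2⁶ ∣ N` every even column is dead and the certified column relations only start to bite at the third odd prime, so the `p = 13` stage alone extends `53 × 15 = 795` assignments against two relations (~6·10⁵ kernel units in all)).  the last part `…PinningThreeTwenty` has the duals, the cover `hcover` (from `hst0 … hst5`), the Fricke sieve, `dim S₂` and the pinning theorems.
HONEST FRAMING: kernel-checked evaluations of integer lists only; nothing here proves C2/C3, Manin's conjecture or BSD.
[cite: CremonaAlgorithms1997, §2.10] [cite: Koehler2011, §2.1]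
-/


set_option autoImplicit false
-- lint-debt: the directory name repeats the summit name (sibling precedent `ManinLocalTwoThreePinningSixtyThree.lean`)
set_option linter.dupNamespace false

noncomputable section


open Complex
open UpperHalfPlane hiding I
open scoped MatrixGroups ModularForm
open ModularForm CongruenceSubgroup
open Literature.NumberTheory.ModularForms
open Literature.NumberTheory.EllipticCurves Literature.NumberTheory.EllipticCurves.ModularForms

namespace Summit.BirchSwinnertonDyer.BirchSwinnertonDyer.Theorems.ManinLocalTwoThree.PinningThreeTwenty

open Summit.BirchSwinnertonDyer.BirchSwinnertonDyer.Theorems.ManinLocalTwoThree.BracketSturm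
open Summit.BirchSwinnertonDyer.BirchSwinnertonDyer.Theorems.ManinLocalTwoThree.PinningKernel


set_option maxHeartbeats 4000000
set_option maxRecDepth 16384

/-! ## §2d-3 Sieve certificates `hst4c11` … `hst5` (stages 4–5) -/

/-- Sieve stage `4`, chunk `11` (kernel `decide`). [folklore] -/
theorem hst4c11 : ∀ σ ∈ sieveStep 320 176 (chunks4.getD 11 []) (stages.getD 4 (0, [])), σ ∈ lvs.getD 4 [] := by decide +kernel
/-- Sieve stage `4`, chunk `12` (kernel `decide`). [folklore] -/
theorem hst4c12 : ∀ σ ∈ sieveStep 320 176 (chunks4.getD 12 []) (stages.getD 4 (0, [])), σ ∈ lvs.getD 4 [] := by decide +kernel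
/-- Sieve stage `4`, chunk `13` (kernel `decide`). [folklore] -/
theorem hst4c13 : ∀ σ ∈ sieveStep 320 176 (chunks4.getD 13 []) (stages.getD 4 (0, [])), σ ∈ lvs.getD 4 [] := by decide +kernel
/-- Sieve stage `4`: the live list `L_4` is mapped into `L_5` (kernel `decide`). [folklore] -/
theorem hst4 : ∀ σ ∈ sieveStep 320 176 ((([[]] : List (List (ℕ × ℤ))) :: lvs).getD 4 []) (stages.getD 4 (0, [])), σ ∈ lvs.getD 4 [] :=
  sieveStep_subset_of_chunks 320 176 chunks4 (by decide +kernel) fun j hj ↦ by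
    have hj' : j < 14 := lt_of_lt_of_eq hj (by decide)
    interval_cases j
    exacts [hst4c0, hst4c1, hst4c2, hst4c3, hst4c4, hst4c5, hst4c6, hst4c7, hst4c8, hst4c9, hst4c10, hst4c11, hst4c12, hst4c13]
/-- Sieve stage `5`: the live list `L_5` is mapped into `L_6` (kernel `decide`). [folklore] -/
theorem hst5 : ∀ σ ∈ sieveStep 320 176 ((([[]] : List (List (ℕ × ℤ))) :: lvs).getD 5 []) (stages.getD 5 (0, [])), σ ∈ lvs.getD 5 [] := by decide +kernel

end Summit.BirchSwinnertonDyer.BirchSwinnertonDyer.Theorems.ManinLocalTwoThree.PinningThreeTwenty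

end
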